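import Mathlib.Analysis.Calculus.ContDiff.Basic
import Mathlib.Analysis.Calculus.IteratedDeriv.Defs
import Mathlib.Analysis.InnerProductSpace.PiL2
import Mathlib.RingTheory.MvPolynomial.Basic
import Mathlib.Topology.Algebra.Support
import HarnessLib

/-!
# Density of polynomials in `𝒞ᵐ(ℝⁿ)` (Weierstrass approximation with derivatives)

Topic `Analysis/Approximation`; namespace `Literature.Analysis.Approximation`. This file STATES, as
a NAMED FACT (CONVENTIONS §4: `def … : Prop`; users take `(h : Treves1967_polynomialsDense_Cm)`;
discharging = landing `theorem Treves1967_polynomialsDense_Cm_holds`), the classical fact that a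
compactly supported `𝒞ᵐ` function on `ℝⁿ` is, together with its derivatives up to order `m`, a
uniform limit on compact sets of polynomials and their derivatives:

* F. Trèves, *Topological Vector Spaces, Distributions and Kernels* (1967), Ch. 15, **Corollary 2
  of Lemma 15.1** (PDF p. 145): "Every function `f ∈ 𝒞_c^m(ℝⁿ)` is the limit, in `𝒞^m(ℝⁿ)`, of a
  sequence of polynomials." (Lemma 15.1 / Corollary 1: the Gauss–Weierstrass transforms
  `f_k = (k/√π)ⁿ ∫ e^{−k²|x−y|²} f(y) dy` are entire and `∂ᵖ f_k → ∂ᵖ f` uniformly on `ℝⁿ` for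
  `|p| ≤ m`; Theorem 15.1: polynomials are dense in the entire functions for the `𝒞^∞` topology.)
  Its open-set form is Corollary 4 of Theorem 15.3 (PDF p. 149): "The polynomials form a dense
  linear subspace of `𝒞ᵏ(Ω)` (`0 ≤ k ≤ +∞`)."

Rendering. The topology of `𝒞^m(ℝⁿ)` is that of uniform convergence on compact subsets of all
derivatives of order `≤ m` (Trèves Ch. 10, Example II); it is translation invariant, so
"`P_k → f` in `𝒞^m`" is "`f − P_k → 0`", i.e. for every compact `K` and `ε > 0` some polynomial `P`
has `sup_{x ∈ K} ‖Dⁱ(f − P)(x)‖ ≤ ε` for all `i ≤ m` — the form stated below, with Mathlib's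
`iteratedFDeriv ℝ i` for `Dⁱ`, `ContDiff ℝ m f ∧ HasCompactSupport f` for `f ∈ 𝒞_c^m(ℝⁿ)`,
`ℝⁿ = EuclideanSpace ℝ (Fin n)`, and a real polynomial `P : MvPolynomial (Fin n) ℝ` evaluated at
the coordinates of `x`. Finite `m : ℕ` only (the case `m = ∞` of the print is not stated). For
`i = 0, 1` the norms are `|f x − P x|` and `‖fderiv ℝ (f − P) x‖` (`norm_iteratedFDeriv_zero`,
`iteratedFDeriv_one_apply`).

Mathlib has the one-dimensional `𝒞⁰` Weierstrass/Bernstein theorems (`polynomialFunctions_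
closure_eq_top`, `bernsteinApproximation_uniform`) and Stone–Weierstrass for `C(K)`; nothing with
derivatives (`lean search 'Nachbin|polynomial.*dense.*deriv'`: no hits), and Literature has none.

Motivation in the tree: the `AnomalousDissipation` route `MomentParity`, item `MomentClosure`
(upgrade of the generator identity from POLYNOMIAL cylindrical test functionals to all cylindrical
test functionals `Φ(u) = φ((u,g₁),…,(u,gₘ))` with `φ ∈ 𝒞_c¹(ℝᵐ)` — exactly the fields
`φ_contDiff : ContDiff ℝ 1 φ`, `φ_compact : HasCompactSupport φ` of
`Literature.Analysis.FluidPDE.Torus.CylindricalTest` — on measures carried by a compact set: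
"C¹-density of polynomials on compacta (Bernstein/Nachbin)").

What is NOT here: no proof (the printed proof is the heat-kernel regularisation + Taylor
truncation of entire functions; ~300 lines over Mathlib's Gaussian integrals); Nachbin's algebra
version; `m = ∞`; the `𝒞ᵏ(Ω)` (open set, no compact support) Corollary 4, which follows from this
one by a cutoff.

## References

* [Treves1967] F. Trèves, *Topological Vector Spaces, Distributions and Kernels*, Academic Press
  1967, Ch. 15: Lemma 15.1, Corollaries 1–2 (PDF pp. 144–145), Theorem 15.3 Corollary 4
  (PDF p. 149). Held: `book:treves1967-topological-vector-spaces-distributions-kernels`.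
-/

namespace Literature.Analysis.Approximation

/-- **Polynomials are dense in `𝒞_c^m(ℝⁿ)` for the `𝒞^m` topology** (Trèves 1967, Ch. 15,
Corollary 2 of Lemma 15.1, PDF p. 145: "Every function `f ∈ 𝒞_c^m(ℝⁿ)` is the limit, in
`𝒞^m(ℝⁿ)`, of a sequence of polynomials."), in `ε`–`K` form: for `f : ℝⁿ → ℝ` of class `𝒞^m`
(`m : ℕ`) with compact support, every compact `K ⊆ ℝⁿ` and every `ε > 0`, there is a real
polynomial `P` in `n` variables with `‖Dⁱ(f − P)(x)‖ ≤ ε` for all `i ≤ m` and all `x ∈ K`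
(`Dⁱ = iteratedFDeriv ℝ i`; `i = 0`: `|f x − P x| ≤ ε`; `i = 1`: `‖fderiv ℝ (f − P) x‖ ≤ ε`).
Named fact, not yet proved in the tree; users take `(h : Treves1967_polynomialsDense_Cm)`.
Serves `Summit.AnomalousDissipation.AnomalousDissipation.Theses.MomentParity.MomentClosure`
(polynomial ⇒ `𝒞_c¹` cylindrical test profiles). [cite: Treves1967, Ch. 15, Cor. 2 of Lemma 15.1, p. 145] -/
def Treves1967_polynomialsDense_Cm : Prop :=
  ∀ (n m : ℕ) (f : EuclideanSpace ℝ (Fin n) → ℝ), ContDiff ℝ m f → HasCompactSupport f →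
    ∀ (K : Set (EuclideanSpace ℝ (Fin n))), IsCompact K → ∀ ε : ℝ, 0 < ε →
      ∃ P : MvPolynomial (Fin n) ℝ, ∀ i : ℕ, i ≤ m → ∀ x ∈ K,
        ‖iteratedFDeriv ℝ i (fun y => f y - MvPolynomial.eval (fun j => y j) P) x‖ ≤ ε

end Literature.Analysis.Approximation
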